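import Summits.QuantumAdvantage.QuantumAdvantage.Theorems.MobiusLadderDigitPolyUniformityWeakGlue

/-!
# Weak glue for the `AC⁰[⊕]` rung, full-range form

Support of line Sketch/LAR of crux stmt-QuantumAdvantage-1392 (`DigitPolyUniformity`), stub Z1
`liouvilleNotAC0Xor_of_inapprox_range`: the multi-length version of
`liouvilleNotAC0Xor_of_inapprox` (`Theorems/MobiusLadderDigitPolyUniformityWeakGlue.lean`).

If for SOME constant `c > 0`, for every `A`, eventually in `n`, every
`P ∈ 𝔽₂[x_0, …, x_{n-1}]` of total degree `≤ (log₂ n)^A` satisfies the ONE-SIDED full-range bound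

  `Σ_{N < 2ⁿ} λ(N) (−1)^{[P(bits N) = 1]} ≤ (1 − c) · 2ⁿ`

(i.e. `[P = 1]` agrees with `[λ = −1]` on at most a `1 − c/2` fraction of `[0, 2ⁿ)`), then the
Liouville language `L_λ = {bin(N) : λ(N) = −1}` is not in `AC⁰[⊕] = AC0Mod 2`.

## Proof
Suppose a circuit family `(C_k)` over `accBasis 2` of depth `≤ d` and size `≤ p(k) ≤ k^κ`
(`κ = deg p + 1`) decides `L_λ`, and fix `t` with `5 < c · 2^t`. For `n` large and EVERY length
`k ∈ [n − t, n]`, the tree's Razborov–Smolensky lemma at length `k`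
(`Smolensky.razborov_smolensky`, `ℓ = κ (log₂ k + 1) + t`) with `exists_mvPolynomial_of_mem_lowDeg`
gives a polynomial `P_k` in `k` variables of total degree `≤ (log₂ k)^{d+1} ≤ (log₂ n)^{d+1}` with
`[P_k = 1] = [λ = −1]` on the block `[2^{k-1}, 2^k)` (where the `k` low bits ARE the code word:
`encodeNat_eq_ofFn`, `ofFn_mem_toLanguage_iff`) off an error set `E_k` with `|E_k| 2^t ≤ 2^k`
(`InapproxRange.exists_poly_at_length`). Glue along the leading digit:
`Q = Σ_{k = n-t}^{n} x_{k-1} Π_{k ≤ j < n} (1 − x_j) · P_k(x_0, …, x_{k-1})`, of total degree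
`≤ (log₂ n)^{d+1} + t + 1 ≤ (log₂ n)^{d+2}`; at the bits of `N ∈ [2^{k-1}, 2^k)` exactly the `k`-th
selector is `1` (`InapproxRange.eval_sum_sel_mul`), so `λ(N) χ_Q(N) = 1` on
`[2^{n-t-1}, 2ⁿ) ∖ ⋃ E_k` and every term is `≥ −1`. Hence (`card_sub_le_sum`)
`Σ_{N<2ⁿ} λ χ_Q ≥ 2ⁿ − 2 (2^{n-t-1} + Σ_k |E_k|) ≥ 2ⁿ − 5 · 2^{n-t} > (1 − c) 2ⁿ`, contradicting the
hypothesis at `A = d + 2`. No property of `λ` beyond `λ(N) ∈ {0, ±1}` (`≠ 0` for `N ≠ 0`) is used.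
-/

namespace Summit.QuantumAdvantage.DigitPolyUniformity.SketchLAR

open Filter Finset
open Literature.Computability.Complexity Literature.Computability.MetaComplexity
open Summit.QuantumAdvantage.QuantumAdvantage.Theorems.MobiusLadder

namespace InapproxRange

/-! ### Leading-digit selector polynomials

For a family `x : ℕ → 𝔽₂[x_0, …, x_{n-1}]` of "variables" (`x j` of total degree `≤ 1`,
evaluating at the bits of `N` to bit `j` of `N`; below, `x j = X_j` for `j < n` and `x j = 0`
otherwise), the selector of the dyadic block `[2^{k-1}, 2^k)` inside `[0, 2ⁿ)` is
`x (k-1) · Π_{k ≤ j < n} (1 − x j)`.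
-/

/-- The variable `X_j` (or `0` when `j ≥ n`) has total degree `≤ 1`. [folklore] -/
theorem totalDegree_dite_X_le (n j : ℕ) :
    (if h : j < n then MvPolynomial.X ⟨j, h⟩ else 0 : MvPolynomial (Fin n) (ZMod 2)).totalDegree
      ≤ 1 := by
  split_ifs
  · rw [MvPolynomial.totalDegree_X]
  · exact MvPolynomial.totalDegree_zero.le.trans (Nat.zero_le _)

/-- At the bit vector of `N < 2ⁿ`, `X_j` (or `0` when `j ≥ n`) evaluates to bit `j` of `N`.
[folklore] -/
theorem eval_dite_X {n N : ℕ} (hN : N < 2 ^ n) (j : ℕ) :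
    MvPolynomial.eval (fun i : Fin n => if Nat.testBit N i then (1 : ZMod 2) else 0)
        (if h : j < n then MvPolynomial.X ⟨j, h⟩ else 0) = if Nat.testBit N j then 1 else 0 := by
  by_cases h : j < n
  · rw [dif_pos h, MvPolynomial.eval_X]
  · rw [dif_neg h, map_zero,
      Nat.testBit_lt_two_pow (hN.trans_le (Nat.pow_le_pow_right two_pos (not_lt.1 h)))]
    simp

/-- The block selector has total degree `≤ 1 + (n − k)`. [folklore] -/
theorem totalDegree_sel_le {n : ℕ} {x : ℕ → MvPolynomial (Fin n) (ZMod 2)}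
    (hx : ∀ j, (x j).totalDegree ≤ 1) (k : ℕ) :
    (x (k - 1) * ∏ j ∈ Finset.Ico k n, (1 - x j)).totalDegree ≤ 1 + (n - k) := by
  refine (MvPolynomial.totalDegree_mul _ _).trans (add_le_add (hx _) ?_)
  calc (∏ j ∈ Finset.Ico k n, (1 - x j)).totalDegree
      ≤ ∑ j ∈ Finset.Ico k n, (1 - x j).totalDegree := MvPolynomial.totalDegree_finsetProd _ _
    _ ≤ ∑ _j ∈ Finset.Ico k n, 1 := Finset.sum_le_sum fun j _ =>
        (MvPolynomial.totalDegree_sub _ _).trans (max_le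
          (MvPolynomial.totalDegree_one.le.trans (Nat.zero_le _)) (hx j))
    _ = n - k := by simp

/-- A sum of selector multiples `Σ_{k ∈ S} sel_k · f_k` with all `k ≥ n − t` and `deg f_k ≤ D` has
total degree `≤ t + 1 + D`. [folklore] -/
theorem totalDegree_sum_sel_mul_le {n t D : ℕ} {x : ℕ → MvPolynomial (Fin n) (ZMod 2)}
    (hx : ∀ j, (x j).totalDegree ≤ 1) {S : Finset ℕ} (hS : ∀ k ∈ S, n - t ≤ k)
    (f : ℕ → MvPolynomial (Fin n) (ZMod 2)) (hf : ∀ k ∈ S, (f k).totalDegree ≤ D) :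
    (∑ k ∈ S, (x (k - 1) * ∏ j ∈ Finset.Ico k n, (1 - x j)) * f k).totalDegree ≤ t + 1 + D := by
  refine MvPolynomial.totalDegree_finsetSum_le fun k hk => ?_
  refine (MvPolynomial.totalDegree_mul _ _).trans (add_le_add ?_ (hf k hk))
  refine (totalDegree_sel_le hx k).trans ?_
  have := hS k hk
  omega

/-- The selector of the block of `N ≠ 0` (length `log₂ N + 1`) is `1` at the bits of `N`.
[folklore] -/
theorem eval_sel_log {n N : ℕ} (hN0 : N ≠ 0) {x : ℕ → MvPolynomial (Fin n) (ZMod 2)}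
    (hx : ∀ j, MvPolynomial.eval (fun i : Fin n => if Nat.testBit N i then (1 : ZMod 2) else 0)
      (x j) = if Nat.testBit N j then 1 else 0) :
    MvPolynomial.eval (fun i : Fin n => if Nat.testBit N i then (1 : ZMod 2) else 0)
      (x (Nat.log 2 N + 1 - 1) * ∏ j ∈ Finset.Ico (Nat.log 2 N + 1) n, (1 - x j)) = 1 := by
  have htop : Nat.testBit N (Nat.log 2 N) = true :=
    Nat.testBit_of_two_pow_le_and_two_pow_add_one_gt (Nat.pow_log_le_self 2 hN0)
      (Nat.lt_pow_succ_log_self one_lt_two N)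
  rw [map_mul, map_prod, hx, Nat.add_sub_cancel, htop, if_pos rfl, one_mul]
  refine Finset.prod_eq_one fun j hj => ?_
  rw [map_sub, map_one, hx, Nat.testBit_lt_two_pow ((Nat.lt_pow_succ_log_self
    one_lt_two N).trans_le (Nat.pow_le_pow_right two_pos (Finset.mem_Ico.1 hj).1))]
  simp

/-- Every other selector vanishes at the bits of `N ≠ 0`, `N < 2ⁿ`. [folklore] -/
theorem eval_sel_of_ne {n N k : ℕ} (hN0 : N ≠ 0) (hN : N < 2 ^ n) (hk : k ≠ Nat.log 2 N + 1)
    {x : ℕ → MvPolynomial (Fin n) (ZMod 2)}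
    (hx : ∀ j, MvPolynomial.eval (fun i : Fin n => if Nat.testBit N i then (1 : ZMod 2) else 0)
      (x j) = if Nat.testBit N j then 1 else 0) :
    MvPolynomial.eval (fun i : Fin n => if Nat.testBit N i then (1 : ZMod 2) else 0)
      (x (k - 1) * ∏ j ∈ Finset.Ico k n, (1 - x j)) = 0 := by
  rw [map_mul, map_prod]
  rcases lt_or_gt_of_ne hk with hlt | hgt
  · -- `k ≤ log₂ N < n`: the factor `1 − x_{log₂ N}` vanishes
    have htop : Nat.testBit N (Nat.log 2 N) = true :=
      Nat.testBit_of_two_pow_le_and_two_pow_add_one_gt (Nat.pow_log_le_self 2 hN0)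
        (Nat.lt_pow_succ_log_self one_lt_two N)
    have hj : Nat.log 2 N ∈ Finset.Ico k n :=
      Finset.mem_Ico.2 ⟨Nat.le_of_lt_succ hlt, Nat.log_lt_of_lt_pow hN0 hN⟩
    rw [Finset.prod_eq_zero hj, mul_zero]
    rw [map_sub, map_one, hx, htop, if_pos rfl, sub_self]
  · -- `k − 1 > log₂ N`: bit `k − 1` of `N` is `0`
    rw [hx, Nat.testBit_lt_two_pow ((Nat.lt_pow_succ_log_self one_lt_two N).trans_le
      (Nat.pow_le_pow_right two_pos (by omega)))]
    simp

/-- **Leading-digit gluing.** At the bits of `N ≠ 0`, `N < 2ⁿ`, the glued polynomial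
`Σ_{k ∈ S} sel_k · f_k` evaluates to `f_{log₂ N + 1}` (if that length is in `S`). [folklore] -/
theorem eval_sum_sel_mul {n N : ℕ} (hN0 : N ≠ 0) (hN : N < 2 ^ n)
    {x : ℕ → MvPolynomial (Fin n) (ZMod 2)}
    (hx : ∀ j, MvPolynomial.eval (fun i : Fin n => if Nat.testBit N i then (1 : ZMod 2) else 0)
      (x j) = if Nat.testBit N j then 1 else 0)
    {S : Finset ℕ} (hS : Nat.log 2 N + 1 ∈ S) (f : ℕ → MvPolynomial (Fin n) (ZMod 2)) :
    MvPolynomial.eval (fun i : Fin n => if Nat.testBit N i then (1 : ZMod 2) else 0)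
        (∑ k ∈ S, (x (k - 1) * ∏ j ∈ Finset.Ico k n, (1 - x j)) * f k) =
      MvPolynomial.eval (fun i : Fin n => if Nat.testBit N i then (1 : ZMod 2) else 0)
        (f (Nat.log 2 N + 1)) := by
  rw [map_sum, Finset.sum_eq_single_of_mem _ hS fun k _ hk => ?_]
  · rw [map_mul, eval_sel_log hN0 hx, one_mul]
  · rw [map_mul, eval_sel_of_ne hN0 hN hk hx, zero_mul]

/-! ### Razborov–Smolensky at one length -/

/-- `bit b = 1 ↔ b`. [folklore] -/
theorem bit_two_eq_one_iff (b : Bool) : Smolensky.bit 2 b = 1 ↔ b = true := by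
  have h01 : (0 : ZMod 2) ≠ 1 := by decide
  cases b <;> simp [h01]

/-- **Razborov–Smolensky at length `k`, transported to `n ≥ k` variables.** If `C_k` (over
`accBasis 2`, depth `≤ d`, size `≤ p(k) ≤ k^κ`) decides `L_λ` at length `k` and
`log₂ k ≥ (2(κ + t))^d`, there are `P ∈ 𝔽₂[x_0, …, x_{n-1}]` of total degree `≤ (log₂ k)^{d+1}`
and an error set `E ⊆ ℕ` with `|E| · 2^t ≤ 2^k` such that `[P(bits N) = 1] = [λ(N) = −1]` for every
`N ∈ [2^{k-1}, 2^k) ∖ E`. (The Razborov–Smolensky step of `liouvilleNotAC0Xor_of_inapprox` at length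
`k`, then `MvPolynomial.rename (Fin.castLE _)`; Smolensky 1987, Lemmas 1–2, as imported.) -/
theorem exists_poly_at_length {d κ t n k : ℕ} {p : Polynomial ℕ} {C : CircuitFamily}
    (hCk : (C k).IsOver (accBasis 2) ∧ (C k).acDepth ≤ d ∧ (C k).size ≤ p.eval k)
    (hdec : C.Decides
      (Computability.encodingNatBool.toLanguage {N : ℕ | ArithmeticFunction.liouville N = -1}))
    (hκ : 1 ≤ κ) (hpk : p.eval k ≤ k ^ κ) (hlog : (2 * (κ + t)) ^ d ≤ Nat.log 2 k)
    (hkn : k ≤ n) :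
    ∃ (P : MvPolynomial (Fin n) (ZMod 2)) (E : Finset ℕ),
      P.totalDegree ≤ Nat.log 2 k ^ (d + 1) ∧ E.card * 2 ^ t ≤ 2 ^ k ∧
        ∀ N : ℕ, N ≠ 0 → Nat.log 2 N + 1 = k → N ∉ E →
          (MvPolynomial.eval (fun i : Fin n => if Nat.testBit N i then (1 : ZMod 2) else 0) P = 1 ↔
            ArithmeticFunction.liouville N = -1) := by
  obtain ⟨hover, hdepth, hsize⟩ := hCk
  set c' : ℕ := 2 * (κ + t) with hc'
  have hcd : 1 ≤ c' ^ d := Nat.one_le_pow _ _ (by omega)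
  have hlog1 : 1 ≤ Nat.log 2 k := hcd.trans hlog
  have hk0 : k ≠ 0 := by
    rintro rfl
    simp at hlog1
  -- Razborov–Smolensky at length `k`
  set ℓ : ℕ := κ * (Nat.log 2 k + 1) + t with hℓ
  have hkℓ : κ ≤ κ * (Nat.log 2 k + 1) := Nat.le_mul_of_pos_right _ (Nat.succ_pos _)
  have hℓ1 : 1 ≤ ℓ := by omega
  obtain ⟨Pf, E, hPf, hE, hagree⟩ := Smolensky.razborov_smolensky (C k) hover hℓ1
  have hℓc : ℓ ≤ c' * Nat.log 2 k := by
    have h2 : κ + t ≤ (κ + t) * Nat.log 2 k := Nat.le_mul_of_pos_right _ hlog1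
    rw [hℓ, hc']
    nlinarith [h2, Nat.zero_le (t * Nat.log 2 k)]
  have hdeg : ((2 - 1) * ℓ) ^ (C k).acDepth ≤ Nat.log 2 k ^ (d + 1) := by
    rw [show (2 - 1) * ℓ = ℓ by omega]
    calc ℓ ^ (C k).acDepth ≤ ℓ ^ d := Nat.pow_le_pow_right hℓ1 hdepth
      _ ≤ (c' * Nat.log 2 k) ^ d := Nat.pow_le_pow_left hℓc d
      _ = c' ^ d * Nat.log 2 k ^ d := mul_pow _ _ _
      _ ≤ Nat.log 2 k * Nat.log 2 k ^ d := Nat.mul_le_mul_right _ hlog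
      _ = Nat.log 2 k ^ (d + 1) := (pow_succ' _ _).symm
  obtain ⟨P, hPdeg, hPeval⟩ :=
    exists_mvPolynomial_of_mem_lowDeg (Smolensky.lowDeg_mono hdeg hPf)
  -- the error set is small: `|E| · 2^t ≤ 2^k`
  have hEt : E.card * 2 ^ t ≤ 2 ^ k := by
    have h5 : k ^ κ * (E.card * 2 ^ t) ≤ k ^ κ * 2 ^ k :=
      calc k ^ κ * (E.card * 2 ^ t) ≤ 2 ^ (κ * (Nat.log 2 k + 1)) * (E.card * 2 ^ t) :=
            Nat.mul_le_mul_right _ (by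
              rw [pow_mul']
              exact Nat.pow_le_pow_left (Nat.lt_pow_succ_log_self one_lt_two k).le _)
        _ = E.card * 2 ^ ℓ := by rw [hℓ, pow_add]; ring
        _ ≤ k ^ κ * 2 ^ k := hE.trans (Nat.mul_le_mul_right _ (hsize.trans hpk))
    exact Nat.le_of_mul_le_mul_left h5 (Nat.pow_pos (Nat.pos_of_ne_zero hk0))
  refine ⟨MvPolynomial.rename (Fin.castLE hkn) P,
    (Finset.range (2 ^ k)).filter (fun N => (fun i : Fin k => Nat.testBit N i) ∈ E),
    (MvPolynomial.totalDegree_rename_le _ _).trans hPdeg,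
    le_trans (Nat.mul_le_mul_right _ ?_) hEt, fun N hN0 hNk hNE => ?_⟩
  · -- the erroneous numbers are at most `|E|`
    refine Finset.card_le_card_of_injOn (fun N => fun i : Fin k => Nat.testBit N i) ?_ ?_
    · intro N hN
      exact Finset.mem_coe.2 (Finset.mem_filter.1 (Finset.mem_coe.1 hN)).2
    · exact (testBit_injOn k).mono fun N hN =>
        Finset.mem_coe.2 (Finset.mem_filter.1 (Finset.mem_coe.1 hN)).1
  · -- on the block, the `k` low bits of `N` are the code word of `N`
    have hNlt : N < 2 ^ k := by
      rw [← hNk]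
      exact Nat.lt_pow_succ_log_self one_lt_two N
    have hNtop : Nat.testBit N (k - 1) = true := by
      rw [← hNk, Nat.add_sub_cancel]
      exact Nat.testBit_of_two_pow_le_and_two_pow_add_one_gt (Nat.pow_log_le_self 2 hN0)
        (Nat.lt_pow_succ_log_self one_lt_two N)
    have hNE' : (fun i : Fin k => Nat.testBit N i) ∉ E := fun h =>
      hNE (Finset.mem_filter.2 ⟨Finset.mem_range.2 hNlt, h⟩)
    have hmem := ofFn_mem_toLanguage_iff {N : ℕ | ArithmeticFunction.liouville N = -1} hNlt hNtop
    rw [Set.mem_setOf_eq] at hmem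
    rw [MvPolynomial.eval_rename,
      show (fun i : Fin n => if Nat.testBit N i then (1 : ZMod 2) else 0) ∘ Fin.castLE hkn =
        fun i : Fin k => if Nat.testBit N i then (1 : ZMod 2) else 0 from rfl,
      hPeval (fun i : Fin k => Nat.testBit N i), hagree _ hNE', hdec.eval_eq, bit_two_eq_one_iff,
      ← hmem]
    exact (Set.mem_iff_boolIndicator _ _).symm

end InapproxRange

open InapproxRange in
/-- **Weak glue, full-range form (stub Z1 of line Sketch/LAR, crux stmt-QuantumAdvantage-1392).**
If for some constant `c > 0`, for every `A`, eventually in `n`, every `P ∈ 𝔽₂[x_0, …, x_{n-1}]`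
of total degree `≤ (log₂ n)^A` has `Σ_{N < 2ⁿ} λ(N) (−1)^{[P(bits N) = 1]} ≤ (1 − c) 2ⁿ` (i.e.
`[P = 1]` agrees with `[λ = −1]` on at most a `1 − c/2` fraction of `[0, 2ⁿ)`), then the Liouville
language `{bin(N) : λ(N) = −1}` is not in `AC⁰[⊕] = AC0Mod 2`.

Proof: with `5 < c 2^t`, a deciding circuit family of depth `d` and size `≤ k^κ` yields at each
of the `t + 1` top lengths `k ∈ [n − t, n]` (Razborov–Smolensky, `exists_poly_at_length`) a
polynomial `P_k` of total degree `≤ (log₂ n)^{d+1}` with `[P_k = 1] = [λ = −1]` on `[2^{k-1}, 2^k)`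
off `E_k`, `|E_k| 2^t ≤ 2^k`; the leading-digit glue `Q = Σ_k x_{k-1} Π_{j ≥ k} (1 − x_j) P_k` has
total degree `≤ (log₂ n)^{d+2}` and
`Σ_{N<2ⁿ} λ χ_Q ≥ 2ⁿ − 2 (2^{n-t-1} + Σ_k |E_k|) ≥ 2ⁿ − 5 · 2^{n-t} > (1 − c) 2ⁿ`, contradicting the
hypothesis at `A = d + 2`. (Smolensky 1987, Lemmas 1–2, as imported.) -/
theorem liouvilleNotAC0Xor_of_inapprox_range :
    (∃ c : ℝ, 0 < c ∧ ∀ A : ℕ, ∀ᶠ n : ℕ in atTop, ∀ P : MvPolynomial (Fin n) (ZMod 2),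
        P.totalDegree ≤ Nat.log 2 n ^ A →
          ∑ N ∈ Finset.range (2 ^ n), ((ArithmeticFunction.liouville N : ℤ) : ℝ) *
              (if MvPolynomial.eval (fun i : Fin n => if Nat.testBit N i then (1 : ZMod 2) else 0) P = 1
                then (-1 : ℝ) else 1) ≤ (1 - c) * (2 : ℝ) ^ n) →
      Computability.encodingNatBool.toLanguage {N : ℕ | ArithmeticFunction.liouville N = -1} ∉
        Literature.Computability.Complexity.AC0Mod 2 := by
  rintro ⟨c, hc, hW⟩ ⟨d, p, C, hC, hdec⟩
  -- the error exponent `t`: `5 < c · 2^t`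
  obtain ⟨t, ht⟩ : ∃ t : ℕ, (5 : ℝ) < c * 2 ^ t := by
    obtain ⟨t, ht⟩ := exists_nat_gt (5 / c)
    have h2t : (t : ℝ) < 2 ^ t := by exact_mod_cast Nat.lt_two_pow_self
    exact ⟨t, by rw [mul_comm]; exact (div_lt_iff₀ hc).1 (ht.trans h2t)⟩
  set κ : ℕ := p.natDegree + 1 with hκ
  set c' : ℕ := 2 * (κ + t) with hc'
  have hpoly : ∀ᶠ m : ℕ in atTop, p.eval m ≤ m ^ κ := by
    refine (eventually_ge_atTop (max 1 (p.eval 1))).mono fun m hm => ?_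
    calc p.eval m ≤ p.eval 1 * m ^ p.natDegree :=
          natPoly_eval_le_eval_one_mul_pow p (le_of_max_le_left hm)
      _ ≤ m * m ^ p.natDegree := Nat.mul_le_mul_right _ (le_of_max_le_right hm)
      _ = m ^ κ := by rw [hκ, pow_succ']
  -- eventually, ALL lengths `k ≥ n − t` are large
  have hev : ∀ᶠ m : ℕ in atTop, ∀ k, m - t ≤ k → p.eval k ≤ k ^ κ ∧ 2 ^ (c' ^ d) ≤ k := by
    obtain ⟨M, hM⟩ := eventually_atTop.1 (hpoly.and (eventually_ge_atTop (2 ^ (c' ^ d))))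
    exact eventually_atTop.2 ⟨M + t, fun m hm k hk => hM k (by omega)⟩
  obtain ⟨n, hn1, hn2, hn3⟩ :=
    ((hW (d + 2)).and (hev.and (eventually_ge_atTop (2 ^ (t + 2))))).exists
  have hlogt : t + 2 ≤ Nat.log 2 n := Nat.le_log_of_pow_le one_lt_two hn3
  have hnt : t + 2 ≤ n := (Nat.lt_two_pow_self).le.trans hn3
  -- per-length Razborov–Smolensky data (junk outside the range of lengths)
  have hdata : ∀ k : ℕ, ∃ (P : MvPolynomial (Fin n) (ZMod 2)) (E : Finset ℕ),
      k ∈ Finset.Icc (n - t) n →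
        P.totalDegree ≤ Nat.log 2 n ^ (d + 1) ∧ E.card * 2 ^ t ≤ 2 ^ k ∧
          ∀ N : ℕ, N ≠ 0 → Nat.log 2 N + 1 = k → N ∉ E → (MvPolynomial.eval
            (fun i : Fin n => if Nat.testBit N i then (1 : ZMod 2) else 0) P = 1 ↔
              ArithmeticFunction.liouville N = -1) := by
    intro k
    by_cases hk : k ∈ Finset.Icc (n - t) n
    · obtain ⟨hk1, hk2⟩ := Finset.mem_Icc.1 hk
      obtain ⟨hpk, hck⟩ := hn2 k hk1
      obtain ⟨P, E, h1, h2, h3⟩ := exists_poly_at_length (t := t) (hC k) hdec (by omega) hpk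
        (Nat.le_log_of_pow_le one_lt_two hck) hk2
      exact ⟨P, E, fun _ =>
        ⟨h1.trans (Nat.pow_le_pow_left (Nat.log_mono_right hk2) _), h2, h3⟩⟩
    · exact ⟨0, ∅, fun h => absurd h hk⟩
  choose Pk Ek hPE using hdata
  -- the "variables" `x j = X_j` (`j < n`), `x j = 0` (`j ≥ n`), and the glued polynomial `Q`
  obtain ⟨x, hx⟩ : ∃ x : ℕ → MvPolynomial (Fin n) (ZMod 2),
      x = fun j => if h : j < n then MvPolynomial.X ⟨j, h⟩ else 0 := ⟨_, rfl⟩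
  have hxdeg : ∀ j, (x j).totalDegree ≤ 1 := fun j => by rw [hx]; exact totalDegree_dite_X_le n j
  obtain ⟨Q, hQ⟩ : ∃ Q : MvPolynomial (Fin n) (ZMod 2),
      Q = ∑ k ∈ Finset.Icc (n - t) n, (x (k - 1) * ∏ j ∈ Finset.Ico k n, (1 - x j)) * Pk k :=
    ⟨_, rfl⟩
  have hQdeg : Q.totalDegree ≤ Nat.log 2 n ^ (d + 2) := by
    rw [hQ]
    refine (totalDegree_sum_sel_mul_le (t := t) hxdeg (fun k hk => (Finset.mem_Icc.1 hk).1) _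
      fun k hk => (hPE k hk).1).trans ?_
    have hL : t + 1 ≤ Nat.log 2 n ^ (d + 1) :=
      calc t + 1 ≤ Nat.log 2 n := by omega
        _ ≤ Nat.log 2 n ^ (d + 1) := Nat.le_self_pow (Nat.succ_ne_zero d) _
    calc t + 1 + Nat.log 2 n ^ (d + 1) ≤ 2 * Nat.log 2 n ^ (d + 1) := by omega
      _ ≤ Nat.log 2 n * Nat.log 2 n ^ (d + 1) := Nat.mul_le_mul_right _ (by omega)
      _ = Nat.log 2 n ^ (d + 2) := (pow_succ' _ _).symm
  -- the one-sided hypothesis for `Q` (with `A = d + 2`)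
  have hSQ := hn1 Q hQdeg
  -- pointwise facts on `[0, 2ⁿ)`: good outside `[0, 2^{n-t-1}) ∪ ⋃ E_k`, `≥ −1` everywhere
  have hgood : ∀ N ∈ Finset.range (2 ^ n),
      ¬ (N < 2 ^ (n - t - 1) ∨ ∃ k ∈ Finset.Icc (n - t) n, N ∈ Ek k) →
      ((ArithmeticFunction.liouville N : ℤ) : ℝ) *
        (if MvPolynomial.eval (fun i : Fin n => if Nat.testBit N i then (1 : ZMod 2) else 0) Q = 1
          then (-1 : ℝ) else 1) = 1 := by
    intro N hN hb
    simp only [not_or, not_exists, not_and, not_lt] at hb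
    obtain ⟨hb1, hb2⟩ := hb
    have hNlt : N < 2 ^ n := Finset.mem_range.1 hN
    have hN0 : N ≠ 0 := ((Nat.two_pow_pos _).trans_le hb1).ne'
    have hkS : Nat.log 2 N + 1 ∈ Finset.Icc (n - t) n := by
      rw [Finset.mem_Icc]
      have h1 : n - t - 1 ≤ Nat.log 2 N := Nat.le_log_of_pow_le one_lt_two hb1
      have h2 : Nat.log 2 N < n := Nat.log_lt_of_lt_pow hN0 hNlt
      omega
    have hiff := (hPE _ hkS).2.2 N hN0 rfl (hb2 _ hkS)
    rw [hQ, eval_sum_sel_mul hN0 hNlt (fun j => by rw [hx]; exact eval_dite_X hNlt j) hkS]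
    rw [ArithmeticFunction.liouville_apply hN0] at hiff ⊢
    rcases neg_one_pow_eq_or ℤ (ArithmeticFunction.cardFactors N) with h1 | h1 <;>
      rw [h1] at hiff ⊢
    · rw [if_neg fun h => absurd (hiff.1 h) (by decide)]; norm_num
    · rw [if_pos (hiff.2 rfl)]; norm_num
  have hbad : ∀ N ∈ Finset.range (2 ^ n), (-1 : ℝ) ≤
      ((ArithmeticFunction.liouville N : ℤ) : ℝ) *
        (if MvPolynomial.eval (fun i : Fin n => if Nat.testBit N i then (1 : ZMod 2) else 0) Q = 1
          then (-1 : ℝ) else 1) := by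
    intro N _
    rcases eq_or_ne N 0 with rfl | hN0
    · simp
    · rw [ArithmeticFunction.liouville_apply hN0]
      rcases neg_one_pow_eq_or ℤ (ArithmeticFunction.cardFactors N) with h1 | h1 <;> rw [h1] <;>
        split_ifs <;> norm_num
  -- the bad set is small
  have hfilt : ((Finset.range (2 ^ n)).filter
      (fun N => N < 2 ^ (n - t - 1) ∨ ∃ k ∈ Finset.Icc (n - t) n, N ∈ Ek k)).card ≤
      2 ^ (n - t - 1) + ∑ k ∈ Finset.Icc (n - t) n, (Ek k).card := by
    calc _ ≤ (Finset.range (2 ^ (n - t - 1)) ∪ (Finset.Icc (n - t) n).biUnion Ek).card := by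
          refine Finset.card_le_card fun N hN => ?_
          rw [Finset.mem_union, Finset.mem_range, Finset.mem_biUnion]
          exact (Finset.mem_filter.1 hN).2
      _ ≤ (Finset.range (2 ^ (n - t - 1))).card + ((Finset.Icc (n - t) n).biUnion Ek).card :=
          Finset.card_union_le _ _
      _ ≤ 2 ^ (n - t - 1) + ∑ k ∈ Finset.Icc (n - t) n, (Ek k).card := by
          rw [Finset.card_range]
          exact Nat.add_le_add_left Finset.card_biUnion_le _
  have hEsum : (∑ k ∈ Finset.Icc (n - t) n, (Ek k).card) * 2 ^ t ≤ 2 ^ (n + 1) := by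
    rw [Finset.sum_mul]
    calc ∑ k ∈ Finset.Icc (n - t) n, (Ek k).card * 2 ^ t ≤ ∑ k ∈ Finset.Icc (n - t) n, 2 ^ k :=
          Finset.sum_le_sum fun k hk => (hPE k hk).2.1
      _ ≤ 2 ^ (n + 1) :=
          (Nat.geomSum_lt le_rfl fun k hk => Nat.lt_succ_of_le (Finset.mem_Icc.1 hk).2).le
  -- lower bound on the sum, and the contradiction
  have hlow := card_sub_le_sum (T := Finset.range (2 ^ n))
    (fun N => N < 2 ^ (n - t - 1) ∨ ∃ k ∈ Finset.Icc (n - t) n, N ∈ Ek k) hgood hbad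
  have h2n : (0 : ℝ) < 2 ^ n := pow_pos two_pos n
  have h2t : (0 : ℝ) < 2 ^ t := pow_pos two_pos t
  have hcardT : ((Finset.range (2 ^ n)).card : ℝ) = 2 ^ n := by
    rw [Finset.card_range, Nat.cast_pow, Nat.cast_ofNat]
  have hfilt' := (Nat.cast_le (α := ℝ)).2 hfilt
  push_cast at hfilt'
  have hEsum' : (∑ k ∈ Finset.Icc (n - t) n, ((Ek k).card : ℝ)) * 2 ^ t ≤ 2 * 2 ^ n := by
    rw [← pow_succ']; exact_mod_cast hEsum
  have hpow : (2 : ℝ) ^ (n - t - 1) * 2 ^ t * 2 = 2 ^ n := by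
    rw [← pow_add, ← pow_succ]; congr 1; omega
  have hkey : 2 * (2 ^ (n - t - 1) + ∑ k ∈ Finset.Icc (n - t) n, ((Ek k).card : ℝ)) <
      c * 2 ^ n := by
    refine lt_of_mul_lt_mul_right ?_ h2t.le
    calc 2 * (2 ^ (n - t - 1) + ∑ k ∈ Finset.Icc (n - t) n, ((Ek k).card : ℝ)) * 2 ^ t
        = 2 ^ (n - t - 1) * 2 ^ t * 2 +
            2 * ((∑ k ∈ Finset.Icc (n - t) n, ((Ek k).card : ℝ)) * 2 ^ t) := by ring
      _ ≤ 2 ^ n + 2 * (2 * 2 ^ n) := by rw [hpow]; linarith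
      _ = 5 * 2 ^ n := by ring
      _ < c * 2 ^ t * 2 ^ n := mul_lt_mul_of_pos_right ht h2n
      _ = c * 2 ^ n * 2 ^ t := by ring
  rw [sub_mul] at hSQ
  linarith

end Summit.QuantumAdvantage.DigitPolyUniformity.SketchLAR
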